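/-
Copyright (c) 2026 the pub-hodgecm-mathlib formalisation cell (harness21).  Prover seat hodgecm-mathlib-A-p19 (g26): «S3-ram» seeding wave (LEAD F0P3a-plan (g12) T11-41∕T11-52,
owner p06 (g15)), row (e2)(b) «[T2-c]-ram», layer 3 (i): the DEFECTIVE involution descent (road «S3-tree», crux H413).
-/
import Mathlib.GroupTheory.Index
import Mathlib.Algebra.Ring.Subring.Basic
import Mathlib.RingTheory.Ideal.Maps
import Mathlib.Tactic.LinearCombination
import Mathlib.Tactic.Ring
import HarnessLib

/-!
# Involution descent without a unit skew element: `Λ = Λ^⋆ ⊕ Λ⁻`, `[Λ : R] = [Λ^⋆ : R^⋆]·[Λ⁻ : R⁻]`, and the defect identity along an anti-fixed regular `π ∈ R`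

Topic `RingTheory/GaloisAlgebras`; namespace `Literature.RingTheory.GaloisAlgebras`.  THEOREMS ONLY (no definition, no instance, no notation, no named fact, no `sorry`); abstract
commutative algebra.  Companion of ★ p846524 `InvolutionDescentUnitIndex` (A-p19): THERE the `⋆`-stable order `R` contains `ξ` with `ξ − ξ⋆` a UNIT and `[Λ : R] = [Λ^⋆ : R^⋆]²`
(`x₁ = (x − x⋆)∕(ξ − ξ⋆)`); that is the INERT∕unramified base.  At a tame-RAMIFIED base no such `ξ` exists (`σ̄ = id`), only `2 ∈ R^×` and an ANTI-FIXED non-zero-divisor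
`π ∈ R` (`π⋆ = −π`, e.g. the uniformiser `Π` of `L_w`, `σ_w Π = −Π`).  HERE: with `h = ⅟2 ∈ R`,
* `exists_addEquiv_fixed_prod_anti` — `Λ^⋆ × Λ⁻ ≃ Λ`, `(x₀, x₁) ↦ x₀ + x₁` (`Λ^⋆ = {x⋆ = x}`, `Λ⁻ = {x⋆ + x = 0}`), pulling a `⋆`-stable subring `R ∋ h` back to `R^⋆ × R⁻`;
* **`index_eq_relIndex_fixed_mul_relIndex_anti`** — `[Λ : R] = [Λ^⋆ : R^⋆]·[Λ⁻ : R⁻]`;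
* `map_mulLeft_fixed_le_anti`, `mulLeft_injective_of_regular` — `x ↦ πx` maps `Λ^⋆ ↪ Λ⁻` and `R^⋆ ↪ R⁻`;
* **`relIndex_anti_mul_relIndex_map_eq`** — THE DEFECT IDENTITY `[Λ⁻ : R⁻]·[R⁻ : πR^⋆] = [Λ^⋆ : R^⋆]·[Λ⁻ : πΛ^⋆]`;
* **`index_mul_relIndex_map_eq_sq_mul`** — `[Λ : R]·[R⁻ : πR^⋆] = [Λ^⋆ : R^⋆]²·[Λ⁻ : πΛ^⋆]` (so `[Λ^⋆ : R^⋆]² = [Λ : R]·q` when `[R⁻ : πR^⋆] = q`, `Λ⁻ = πΛ^⋆` — the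
  type-A torus at a tame-ramified place — and `= [Λ : R]` when both defects are `q` — type B; A-p19 CERT «[T2-c]-ram» 22:01Z).
All indices are Mathlib `AddSubgroup.index`∕`relIndex` (value `0` for infinite index; the identities hold in `ℕ` unconditionally).
HONEST LABEL: HC_CM is proved only modulo the 2 remaining named inputs (hLiu418 24832, h413 24833) until rung 0 closes; unconditional algebra, count-neutral.

## References
* [Hungerford1974] T. W. Hungerford, *Algebra*, GTM 73 (1974): Ch. I Thm. 4.5 (index of nested subgroups), Ch. IV §1.
* [Neukirch1999] J. Neukirch, *Algebraic Number Theory* (1999): Ch. I §12 (orders and conductors).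
* [SerreLocalFields1979] J.-P. Serre, *Local Fields*, GTM 67 (1979): Ch. V §3 (tamely ramified quadratic extensions).
-/

set_option autoImplicit false

namespace Literature.RingTheory.GaloisAlgebras

section Defect

variable {Λ : Type*} [CommRing Λ] (s : Λ →+* Λ) (hss : ∀ x, s (s x) = x) {h : Λ} (hh : h * 2 = 1)

include hh in
/-- `h⋆ = h` for `h = ⅟2` (uniqueness of the inverse of `2`). [cite: Hungerford1974, Ch. IV §1] -/
theorem map_half_eq : s h = h := by
  have h1 : s h * 2 = 1 := by have := congrArg s hh; rwa [map_mul, map_ofNat, map_one] at this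
  calc s h = s h * (h * 2) := by rw [hh, mul_one]
    _ = (s h * 2) * h := by ring
    _ = h := by rw [h1, one_mul]

include hss hh in
/-- **THE DECOMPOSITION `x = h(x + x⋆) + h(x − x⋆)`** into a `⋆`-fixed and a `⋆`-anti-fixed part. [cite: Hungerford1974, Ch. IV §1] -/
theorem fixed_anti_decomposition (x : Λ) :
    s (h * (x + s x)) = h * (x + s x) ∧ s (h * (x - s x)) + h * (x - s x) = 0 ∧ h * (x + s x) + h * (x - s x) = x := by
  have hsh := map_half_eq s hh
  refine ⟨?_, ?_, ?_⟩
  · rw [map_mul, hsh, map_add, hss, add_comm]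
  · rw [map_mul, hsh, map_sub, hss]; ring
  · calc h * (x + s x) + h * (x - s x) = (h * 2) * x := by ring
      _ = x := by rw [hh, one_mul]

include hss hh in
/-- **`Λ^⋆ × Λ⁻ ≃ Λ` ADDITIVELY**, `(x₀, x₁) ↦ x₀ + x₁` (`Λ^⋆ = eqLocus ⋆ id`, `Λ⁻ = ker (⋆ + id)`); a `⋆`-stable subring `R ∋ h` pulls back to `R^⋆ × R⁻`.
[cite: Hungerford1974, Ch. I Thm. 4.5] -/
theorem exists_addEquiv_fixed_prod_anti (R : Subring Λ) (hsR : ∀ x ∈ R, s x ∈ R) (hhR : h ∈ R) :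
    ∃ Θ : (RingHom.eqLocus s (RingHom.id Λ)).toAddSubgroup × (s.toAddMonoidHom + AddMonoidHom.id Λ).ker ≃+ Λ,
      (∀ p, Θ p = (p.1 : Λ) + (p.2 : Λ)) ∧
      R.toAddSubgroup.comap Θ.toAddMonoidHom =
        (R.toAddSubgroup.addSubgroupOf (RingHom.eqLocus s (RingHom.id Λ)).toAddSubgroup).prod
          (R.toAddSubgroup.addSubgroupOf (s.toAddMonoidHom + AddMonoidHom.id Λ).ker) := by
  set B : AddSubgroup Λ := (RingHom.eqLocus s (RingHom.id Λ)).toAddSubgroup with hB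
  set A : AddSubgroup Λ := (s.toAddMonoidHom + AddMonoidHom.id Λ).ker with hA
  have hmemB : ∀ x : Λ, x ∈ B ↔ s x = x := fun x => by rw [hB]; exact Iff.rfl
  have hmemA : ∀ x : Λ, x ∈ A ↔ s x + x = 0 := fun x => by rw [hA, AddMonoidHom.mem_ker]; rfl
  set Θ₀ : B × A →+ Λ :=
    { toFun := fun p => (p.1 : Λ) + (p.2 : Λ)
      map_zero' := by simp
      map_add' := fun p q => by
        simp only [Prod.fst_add, Prod.snd_add, AddSubgroup.coe_add]; ring } with hΘ₀
  have hΘ₀apply : ∀ p, Θ₀ p = (p.1 : Λ) + (p.2 : Λ) := fun _ => rfl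
  -- the coordinate identities: `h((x₀+x₁) + (x₀+x₁)⋆) = x₀`, `h((x₀+x₁) − (x₀+x₁)⋆) = x₁`
  have hc0 : ∀ (x₀ x₁ : Λ), s x₀ = x₀ → s x₁ + x₁ = 0 → h * ((x₀ + x₁) + s (x₀ + x₁)) = x₀ := by
    intro x₀ x₁ h0 h1
    rw [map_add, h0, show s x₁ = -x₁ by linear_combination h1]
    calc h * (x₀ + x₁ + (x₀ + -x₁)) = (h * 2) * x₀ := by ring
      _ = x₀ := by rw [hh, one_mul]
  have hc1 : ∀ (x₀ x₁ : Λ), s x₀ = x₀ → s x₁ + x₁ = 0 → h * ((x₀ + x₁) - s (x₀ + x₁)) = x₁ := by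
    intro x₀ x₁ h0 h1
    rw [map_add, h0, show s x₁ = -x₁ by linear_combination h1]
    calc h * (x₀ + x₁ - (x₀ + -x₁)) = (h * 2) * x₁ := by ring
      _ = x₁ := by rw [hh, one_mul]
  have hbij : Function.Bijective Θ₀ := by
    constructor
    · rintro ⟨⟨x₀, hx₀⟩, ⟨x₁, hx₁⟩⟩ ⟨⟨y₀, hy₀⟩, ⟨y₁, hy₁⟩⟩ heq
      simp only [hΘ₀apply] at heq
      rw [hmemB] at hx₀ hy₀
      rw [hmemA] at hx₁ hy₁
      have h0 : x₀ = y₀ := by rw [← hc0 x₀ x₁ hx₀ hx₁, ← hc0 y₀ y₁ hy₀ hy₁, heq]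
      have h1 : x₁ = y₁ := by rw [← hc1 x₀ x₁ hx₀ hx₁, ← hc1 y₀ y₁ hy₀ hy₁, heq]
      simp only [h0, h1]
    · intro x
      obtain ⟨h0, h1, hsum⟩ := fixed_anti_decomposition s hss hh x
      exact ⟨(⟨h * (x + s x), (hmemB _).2 h0⟩, ⟨h * (x - s x), (hmemA _).2 h1⟩), by rw [hΘ₀apply]; exact hsum⟩
  refine ⟨AddEquiv.ofBijective Θ₀ hbij, fun p => rfl, ?_⟩
  ext ⟨⟨x₀, hx₀⟩, ⟨x₁, hx₁⟩⟩
  simp only [AddSubgroup.mem_comap, AddSubgroup.mem_prod, AddSubgroup.mem_addSubgroupOf, Subring.mem_toAddSubgroup]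
  change x₀ + x₁ ∈ R ↔ x₀ ∈ R ∧ x₁ ∈ R
  rw [hmemB] at hx₀
  rw [hmemA] at hx₁
  constructor
  · intro hx
    exact ⟨by rw [← hc0 x₀ x₁ hx₀ hx₁]; exact R.mul_mem hhR (R.add_mem hx (hsR _ hx)),
      by rw [← hc1 x₀ x₁ hx₀ hx₁]; exact R.mul_mem hhR (R.sub_mem hx (hsR _ hx))⟩
  · rintro ⟨h0, h1⟩
    exact R.add_mem h0 h1

include hss hh in
/-- **`[Λ : R] = [Λ^⋆ : R^⋆] · [Λ⁻ : R⁻]`** for a `⋆`-stable subring `R ∋ ⅟2` (`R^⋆ = R ∩ Λ^⋆`, `R⁻ = R ∩ Λ⁻` read inside `Λ^⋆`, `Λ⁻`; Mathlib `AddSubgroup.index_prod`).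
[cite: Hungerford1974, Ch. I Thm. 4.5] -/
theorem index_eq_relIndex_fixed_mul_relIndex_anti (R : Subring Λ) (hsR : ∀ x ∈ R, s x ∈ R) (hhR : h ∈ R) :
    R.toAddSubgroup.index =
      R.toAddSubgroup.relIndex (RingHom.eqLocus s (RingHom.id Λ)).toAddSubgroup * R.toAddSubgroup.relIndex (s.toAddMonoidHom + AddMonoidHom.id Λ).ker := by
  obtain ⟨Θ, -, hΘ⟩ := exists_addEquiv_fixed_prod_anti s hss hh R hsR hhR
  rw [← AddSubgroup.index_comap_of_surjective R.toAddSubgroup (f := Θ.toAddMonoidHom) Θ.surjective, hΘ, AddSubgroup.index_prod]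
  rfl

/-! ## The defect along an anti-fixed regular element `π` -/

variable {π : Λ} (hπs : s π = -π) (hπ : ∀ x, π * x = 0 → x = 0)

include hπs in
/-- `x ↦ πx` maps `⋆`-fixed elements to `⋆`-anti-fixed ones (`(πx)⋆ = −πx`). [cite: Hungerford1974, Ch. IV §1] -/
theorem map_mulLeft_fixed_le_anti :
    ((RingHom.eqLocus s (RingHom.id Λ)).toAddSubgroup).map (AddMonoidHom.mulLeft π) ≤ (s.toAddMonoidHom + AddMonoidHom.id Λ).ker := by
  rintro y ⟨x, hx, rfl⟩
  have hx' : s x = x := hx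
  rw [AddMonoidHom.mem_ker]
  change s (π * x) + π * x = 0
  rw [map_mul, hπs, hx']; ring

include hπ in
/-- `x ↦ πx` is injective when `π` is a non-zero-divisor. [cite: Hungerford1974, Ch. IV §1] -/
theorem mulLeft_injective_of_regular : Function.Injective (AddMonoidHom.mulLeft π : Λ →+ Λ) := by
  intro x y hxy
  have h0 : π * (x - y) = 0 := by rw [mul_sub]; exact sub_eq_zero.2 hxy
  exact sub_eq_zero.1 (hπ _ h0)

include hπs in
/-- `πR^⋆ ⊆ R⁻` for a subring `R ∋ π`. [cite: Hungerford1974, Ch. IV §1] -/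
theorem map_mulLeft_inf_fixed_le (R : Subring Λ) (hπR : π ∈ R) :
    (R.toAddSubgroup ⊓ (RingHom.eqLocus s (RingHom.id Λ)).toAddSubgroup).map (AddMonoidHom.mulLeft π) ≤
      R.toAddSubgroup ⊓ (s.toAddMonoidHom + AddMonoidHom.id Λ).ker := by
  rintro y ⟨x, ⟨hxR, hx⟩, rfl⟩
  refine ⟨R.mul_mem hπR hxR, ?_⟩
  exact map_mulLeft_fixed_le_anti s hπs ⟨x, hx, rfl⟩

include hπs hπ in
/-- **THE DEFECT IDENTITY**: for a subring `R ∋ π` (`π⋆ = −π`, `π` regular),  **`[Λ⁻ : R⁻] · [R⁻ : πR^⋆] = [Λ^⋆ : R^⋆] · [Λ⁻ : πΛ^⋆]`**  (both sides equal `[Λ⁻ : πR^⋆]`;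
`[πΛ^⋆ : πR^⋆] = [Λ^⋆ : R^⋆]` by injectivity of `x ↦ πx`). [cite: Hungerford1974, Ch. I Thm. 4.5] [cite: Neukirch1999, Ch. I §12] -/
theorem relIndex_anti_mul_relIndex_map_eq (R : Subring Λ) (hπR : π ∈ R) :
    R.toAddSubgroup.relIndex (s.toAddMonoidHom + AddMonoidHom.id Λ).ker *
        ((R.toAddSubgroup ⊓ (RingHom.eqLocus s (RingHom.id Λ)).toAddSubgroup).map (AddMonoidHom.mulLeft π)).relIndex
          (R.toAddSubgroup ⊓ (s.toAddMonoidHom + AddMonoidHom.id Λ).ker) =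
      R.toAddSubgroup.relIndex (RingHom.eqLocus s (RingHom.id Λ)).toAddSubgroup *
        (((RingHom.eqLocus s (RingHom.id Λ)).toAddSubgroup).map (AddMonoidHom.mulLeft π)).relIndex (s.toAddMonoidHom + AddMonoidHom.id Λ).ker := by
  set B : AddSubgroup Λ := (RingHom.eqLocus s (RingHom.id Λ)).toAddSubgroup with hB
  set A : AddSubgroup Λ := (s.toAddMonoidHom + AddMonoidHom.id Λ).ker with hA
  set μ : Λ →+ Λ := AddMonoidHom.mulLeft π with hμ
  set H₁ : AddSubgroup Λ := (R.toAddSubgroup ⊓ B).map μ with hH₁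
  set K₁ : AddSubgroup Λ := R.toAddSubgroup ⊓ A with hK₁
  set K₂ : AddSubgroup Λ := B.map μ with hK₂
  have h1 : H₁ ≤ K₁ := map_mulLeft_inf_fixed_le s hπs R hπR
  have h2 : K₁ ≤ A := inf_le_right
  have h3 : H₁ ≤ K₂ := AddSubgroup.map_mono inf_le_right
  have h4 : K₂ ≤ A := map_mulLeft_fixed_le_anti s hπs
  -- `[A : H₁]` computed through `K₁` and through `K₂`
  have e1 := AddSubgroup.relIndex_mul_relIndex H₁ K₁ A h1 h2
  have e2 := AddSubgroup.relIndex_mul_relIndex H₁ K₂ A h3 h4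
  -- `[K₂ : H₁] = [B : R ⊓ B]` (injectivity of `μ`), `[A : K₁] = [A : R]`, `[B : R ⊓ B] = [B : R]`
  have e3 : H₁.relIndex K₂ = R.toAddSubgroup.relIndex B := by
    rw [hH₁, hK₂, AddSubgroup.relIndex_map_map_of_injective _ _ (mulLeft_injective_of_regular hπ), AddSubgroup.inf_relIndex_right]
  have e4 : K₁.relIndex A = R.toAddSubgroup.relIndex A := by rw [hK₁, AddSubgroup.inf_relIndex_right]
  rw [← e4, mul_comm (K₁.relIndex A), e1, ← e2, e3]

include hss hh hπs hπ in
/-- **`[Λ : R] · [R⁻ : πR^⋆] = [Λ^⋆ : R^⋆]² · [Λ⁻ : πΛ^⋆]`** for a `⋆`-stable subring `R ∋ ⅟2, π` — the ramified-base replacement of ★ `index_eq_relIndex_eqLocus_sq`.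
[cite: Hungerford1974, Ch. I Thm. 4.5] [cite: Neukirch1999, Ch. I §12] [cite: SerreLocalFields1979, Ch. V §3] -/
theorem index_mul_relIndex_map_eq_sq_mul (R : Subring Λ) (hsR : ∀ x ∈ R, s x ∈ R) (hhR : h ∈ R) (hπR : π ∈ R) :
    R.toAddSubgroup.index *
        ((R.toAddSubgroup ⊓ (RingHom.eqLocus s (RingHom.id Λ)).toAddSubgroup).map (AddMonoidHom.mulLeft π)).relIndex
          (R.toAddSubgroup ⊓ (s.toAddMonoidHom + AddMonoidHom.id Λ).ker) =
      (R.toAddSubgroup.relIndex (RingHom.eqLocus s (RingHom.id Λ)).toAddSubgroup) ^ 2 *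
        (((RingHom.eqLocus s (RingHom.id Λ)).toAddSubgroup).map (AddMonoidHom.mulLeft π)).relIndex (s.toAddMonoidHom + AddMonoidHom.id Λ).ker := by
  rw [index_eq_relIndex_fixed_mul_relIndex_anti s hss hh R hsR hhR, mul_assoc, relIndex_anti_mul_relIndex_map_eq s hπs hπ R hπR, sq, mul_assoc]

end Defect

end Literature.RingTheory.GaloisAlgebras
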